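import Literature.NumberTheory.EllipticCurves.ModularSymbolsCoefficients
import Literature.NumberTheory.EllipticCurves.PAdicMeasureWeightKActionLaw
import Mathlib.Algebra.MvPolynomial.Funext
import HarnessLib

/-!
# The coefficient system `𝔻_k(ℤ_p)` of weight-`k` measures on `Σ₀`, and the specialisation of
# `𝔻_k`-valued modular symbols to `Symᵏ`-valued ones

Instances for `ModularSymbolsCoefficients`, following Bellaïche 2011, §3.2.1–3.2.3 (measures =
bounded distributions in place of locally analytic distributions: the ordinary setting):

* the semigroup `sigma0Set N = {M ∈ M₂(ℤ) : det M ≠ 0, N ∣ c, (a, N) = 1} ⊇ Γ₀(N), ∋ βᵢ`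
  (`coe_mem_sigma0Set`, `heckeRep_mem_sigma0Set`); for `p ∣ N` its elements satisfy `‖a‖_p = 1`,
  `‖c‖_p < 1` (`norm_entries_of_mem_sigma0Set`), i.e. lie in `Σ₀(p)`;
* the **coefficient system `distCoeff p 𝕜 k N`** on `sigma0Set N` (for `p ∣ N`): the module `𝔻(ℤ_p)`
  of bounded `𝕜`-valued distributions with `ρ(M) = weightActD k M` (`PAdicMeasureWeightKActionLaw`,
  right action by `weightActD_mul`, `weightActD_one`);
* the **moment form as a linear map** `formOfₗ k : 𝔻(ℤ_p) →ₗ ℚ_p^{k+1}` and the VECTOR form of its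
  equivariance `formOfₗ k (μ|_kM) = Symᵏ(M) · formOfₗ k μ` (`formOfₗ_weightActD`, from
  `evalVec_formOf_weightAct` and the injectivity of `evalVec` over an infinite field), whence the
  **specialisation morphism** `specHom : distCoeff → symPowOn` (`ρ_k^*` of Bellaïche §3.2.3);
* the headline: **a `𝔻_k`-valued modular symbol for `Γ₀(N)` specialises to a `Symᵏ`-valued one,
  `U_p`-equivariantly** (`spec_mem_Symb`, `spec_hecke`).

Everything here is over `𝕜 = ℚ_p` for the vector form (the functional form in
`PAdicMeasureWeightKActionLaw` is over any complete non-archimedean `ℚ_p`-algebra).  Brick B3d of the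
bottom-up plan recorded with the named fact
`greenbergStevens_kitagawa_twoVariable_interpolation_allBranches`.  Everything is proved; no named facts.

## References

* J. Bellaïche, *Critical `p`-adic `L`-functions*, Invent. Math. 189 (2012), §3.2. [Bellaiche2011]
* R. Pollack, G. Stevens, Ann. Sci. ÉNS 44 (2011), §2–3. [PollackStevens2011]
-/

noncomputable section

open scoped MatrixGroups
open CongruenceSubgroup Matrix

namespace Literature.NumberTheory.EllipticCurves

open ModularForms ModularForms.HidaCohomology

/-! ### The semigroup `Σ₀(N)` of integer matrices -/

section Sigma0

/-- **`Σ₀(N) = {M ∈ M₂(ℤ) : det M ≠ 0, N ∣ c, gcd(a, N) = 1}`** (the union of the `Delta0 N n`, `n ≠ 0`,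
of `HeckeOperatorsGamma0Proofs`). [cite: Shimura1971, §3.3] -/
def sigma0Set (N : ℕ) : Set (Matrix (Fin 2) (Fin 2) ℤ) :=
  {M | M.det ≠ 0 ∧ (N : ℤ) ∣ M 1 0 ∧ IsCoprime (M 0 0) N}

/-- `Delta0 N n ⊆ Σ₀(N)` for `n ≠ 0`. [folklore] -/
theorem mem_sigma0Set_of_mem_delta0 {N : ℕ} {n : ℤ} (hn : n ≠ 0) {M : Matrix (Fin 2) (Fin 2) ℤ}
    (hM : M ∈ Delta0 N n) : M ∈ sigma0Set N :=
  ⟨by rw [hM.1]; exact hn, hM.2.1, hM.2.2⟩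

/-- `Γ₀(N) ⊆ Σ₀(N)`. [folklore] -/
theorem coe_mem_sigma0Set {N : ℕ} (γ : Gamma0 N) : gmat γ ∈ sigma0Set N :=
  mem_sigma0Set_of_mem_delta0 one_ne_zero (coe_mem_delta0_one γ)

/-- Elements of `Γ₀(N)`, as elements of `SL(2, ℤ)`, lie in `Σ₀(N)`. [folklore] -/
theorem coe_mem_sigma0Set' {N : ℕ} (γ : SL(2, ℤ)) (hγ : γ ∈ Gamma0 N) :
    (γ : Matrix (Fin 2) (Fin 2) ℤ) ∈ sigma0Set N :=
  coe_mem_sigma0Set ⟨γ, hγ⟩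

/-- The Hecke representatives lie in `Σ₀(N)`. [folklore] -/
theorem heckeRep_mem_sigma0Set {N p : ℕ} (hp : p.Prime) (i : HeckeIdx N p) : heckeRep p i.1 ∈ sigma0Set N :=
  mem_sigma0Set_of_mem_delta0 (by exact_mod_cast hp.ne_zero) (heckeRep_mem_delta0 hp i)

/-- **For `p ∣ N`, `Σ₀(N) ⊆ Σ₀(p)`**: `‖a‖_p = 1` and `‖c‖_p < 1`. [folklore] -/
theorem norm_entries_of_mem_sigma0Set {p : ℕ} [Fact p.Prime] {N : ℕ} (hpN : p ∣ N)
    {M : Matrix (Fin 2) (Fin 2) ℤ} (hM : M ∈ sigma0Set N) :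
    ‖((M 0 0 : ℤ) : ℤ_[p])‖ = 1 ∧ ‖((M 1 0 : ℤ) : ℤ_[p])‖ < 1 := by
  obtain ⟨-, hc, ha⟩ := hM
  have hpN' : (p : ℤ) ∣ (N : ℤ) := Int.natCast_dvd_natCast.mpr hpN
  refine ⟨?_, (PadicInt.norm_int_lt_one_iff_dvd _).mpr (hpN'.trans hc)⟩
  -- `(a, N) = 1` and `p ∣ N` give `p ∤ a`
  have hpa : ¬ (p : ℤ) ∣ M 0 0 := by
    intro h
    have h1 : (p : ℤ) ∣ 1 := by
      obtain ⟨u, v, huv⟩ := ha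
      rw [← huv]
      exact dvd_add (dvd_mul_of_dvd_right h u) (dvd_mul_of_dvd_right hpN' v)
    have := Int.eq_one_of_dvd_one (by positivity) h1
    exact (Fact.out : p.Prime).one_lt.ne' (by exact_mod_cast this)
  have hlt : ¬ ‖((M 0 0 : ℤ) : ℤ_[p])‖ < 1 := fun h => hpa ((PadicInt.norm_int_lt_one_iff_dvd _).mp h)
  exact le_antisymm (PadicInt.norm_le_one _) (not_lt.mp hlt)

end Sigma0

/-! ### The coefficient system of weight-`k` measures -/

section DistCoeff

variable (p : ℕ) [Fact p.Prime] (𝕜 : Type*) [NormedField 𝕜] [NormedAlgebra ℚ_[p] 𝕜] [IsUltrametricDist 𝕜]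
  [CompleteSpace 𝕜]

/-- The operator of an integer matrix on `𝔻(ℤ_p)`: `weightActD k M` for `M ∈ Σ₀(p)` (`‖a‖ = 1`,
`‖c‖ < 1`), the identity otherwise (junk). [folklore] -/
def distρ (k : ℕ) (M : Matrix (Fin 2) (Fin 2) ℤ) :
    (ProfiniteTower.padicInt p).distributions 𝕜 →ₗ[𝕜] (ProfiniteTower.padicInt p).distributions 𝕜 :=
  if h : ‖((M 0 0 : ℤ) : ℤ_[p])‖ = 1 ∧ ‖((M 1 0 : ℤ) : ℤ_[p])‖ < 1 then
    weightActD p 𝕜 k h.1 h.2 ((M 0 1 : ℤ) : ℤ_[p]) ((M 1 1 : ℤ) : ℤ_[p])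
  else LinearMap.id

variable {p 𝕜}

/-- Unfolding `distρ` on `Σ₀(p)`. [folklore] -/
theorem distρ_eq (k : ℕ) {M : Matrix (Fin 2) (Fin 2) ℤ}
    (h : ‖((M 0 0 : ℤ) : ℤ_[p])‖ = 1 ∧ ‖((M 1 0 : ℤ) : ℤ_[p])‖ < 1) :
    distρ p 𝕜 k M = weightActD p 𝕜 k h.1 h.2 ((M 0 1 : ℤ) : ℤ_[p]) ((M 1 1 : ℤ) : ℤ_[p]) := by
  rw [distρ, dif_pos h]

/-- Congruence for `weightActD` in its matrix entries (which carry proofs). [folklore] -/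
theorem weightActD_congr (k : ℕ) {a c a' c' b d b' d' : ℤ_[p]} (ha : ‖a‖ = 1) (hc : ‖c‖ < 1)
    (ha' : ‖a'‖ = 1) (hc' : ‖c'‖ < 1) (h1 : a = a') (h2 : b = b') (h3 : c = c') (h4 : d = d') :
    weightActD p 𝕜 k ha hc b d = weightActD p 𝕜 k ha' hc' b' d' := by
  subst h1 h2 h3 h4; rfl

variable (p 𝕜) in
/-- **The coefficient system `𝔻_k` on `Σ₀(N)`** (`p ∣ N`): bounded `𝕜`-valued distributions on `ℤ_p`
with the weight-`k` action `μ ↦ μ |_k M` (Bellaïche 2011, §3.2.1, dual action on `𝔻`).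
[cite: Bellaiche2011, §3.2.1] -/
def distCoeff (k N : ℕ) (hpN : p ∣ N) :
    CoeffActionOn (sigma0Set N) 𝕜 ((ProfiniteTower.padicInt p).distributions 𝕜) where
  ρ := distρ p 𝕜 k
  ρ_mul M hM M' hM' := by
    have h := norm_entries_of_mem_sigma0Set hpN hM
    have h' := norm_entries_of_mem_sigma0Set hpN hM'
    have hMM' : M * M' ∈ sigma0Set N := by
      refine ⟨by rw [Matrix.det_mul]; exact mul_ne_zero hM.1 hM'.1, ?_, ?_⟩
      · have e : (M * M') 1 0 = M 1 0 * M' 0 0 + M 1 1 * M' 1 0 := by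
          simp [Matrix.mul_apply, Fin.sum_univ_two]
        rw [e]
        exact dvd_add (dvd_mul_of_dvd_left hM.2.1 _) (dvd_mul_of_dvd_right hM'.2.1 _)
      · have e : (M * M') 0 0 = M 0 0 * M' 0 0 + M 0 1 * M' 1 0 := by
          simp [Matrix.mul_apply, Fin.sum_univ_two]
        obtain ⟨t, ht⟩ := hM'.2.1
        rw [e, ht, show M 0 1 * ((N : ℤ) * t) = (N : ℤ) * (M 0 1 * t) by ring]
        exact (IsCoprime.mul_left hM.2.2 hM'.2.2).add_mul_left_left (M 0 1 * t)
    have hh := norm_entries_of_mem_sigma0Set hpN hMM'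
    have e00 : (((M * M') 0 0 : ℤ) : ℤ_[p]) = ((M 0 0 : ℤ) : ℤ_[p]) * ((M' 0 0 : ℤ) : ℤ_[p]) +
        ((M 0 1 : ℤ) : ℤ_[p]) * ((M' 1 0 : ℤ) : ℤ_[p]) := by
      simp [Matrix.mul_apply, Fin.sum_univ_two]
    have e01 : (((M * M') 0 1 : ℤ) : ℤ_[p]) = ((M 0 0 : ℤ) : ℤ_[p]) * ((M' 0 1 : ℤ) : ℤ_[p]) +
        ((M 0 1 : ℤ) : ℤ_[p]) * ((M' 1 1 : ℤ) : ℤ_[p]) := by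
      simp [Matrix.mul_apply, Fin.sum_univ_two]
    have e10 : (((M * M') 1 0 : ℤ) : ℤ_[p]) = ((M 1 0 : ℤ) : ℤ_[p]) * ((M' 0 0 : ℤ) : ℤ_[p]) +
        ((M 1 1 : ℤ) : ℤ_[p]) * ((M' 1 0 : ℤ) : ℤ_[p]) := by
      simp [Matrix.mul_apply, Fin.sum_univ_two]
    have e11 : (((M * M') 1 1 : ℤ) : ℤ_[p]) = ((M 1 0 : ℤ) : ℤ_[p]) * ((M' 0 1 : ℤ) : ℤ_[p]) +
        ((M 1 1 : ℤ) : ℤ_[p]) * ((M' 1 1 : ℤ) : ℤ_[p]) := by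
      simp [Matrix.mul_apply, Fin.sum_univ_two]
    have hA : ‖((M 0 0 : ℤ) : ℤ_[p]) * ((M' 0 0 : ℤ) : ℤ_[p]) + ((M 0 1 : ℤ) : ℤ_[p]) * ((M' 1 0 : ℤ) : ℤ_[p])‖ = 1 := by
      rw [← e00]; exact hh.1
    have hC : ‖((M 1 0 : ℤ) : ℤ_[p]) * ((M' 0 0 : ℤ) : ℤ_[p]) + ((M 1 1 : ℤ) : ℤ_[p]) * ((M' 1 0 : ℤ) : ℤ_[p])‖ < 1 := by
      rw [← e10]; exact hh.2
    rw [distρ_eq k hh, distρ_eq k h, distρ_eq k h', weightActD_congr k hh.1 hh.2 hA hC e00 e01 e10 e11,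
      weightActD_mul k h.1 h.2 h'.1 h'.2 _ _ _ _ hA hC]
  ρ_one := by
    have h : ‖(((1 : Matrix (Fin 2) (Fin 2) ℤ) 0 0 : ℤ) : ℤ_[p])‖ = 1 ∧
        ‖(((1 : Matrix (Fin 2) (Fin 2) ℤ) 1 0 : ℤ) : ℤ_[p])‖ < 1 := by
      simp
    rw [distρ_eq k h]
    have h1 : ‖(1 : ℤ_[p])‖ = 1 := norm_one
    have h0 : ‖(0 : ℤ_[p])‖ < 1 := by rw [norm_zero]; exact one_pos
    rw [weightActD_congr k h.1 h.2 h1 h0 (b' := 0) (d' := 1) (by simp) (by simp) (by simp) (by simp)]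
    exact weightActD_one k h1 h0

/-- The operators of `distCoeff`. [folklore] -/
theorem distCoeff_ρ (k N : ℕ) (hpN : p ∣ N) (M : Matrix (Fin 2) (Fin 2) ℤ) :
    (distCoeff p 𝕜 k N hpN).ρ M = distρ p 𝕜 k M := rfl

end DistCoeff

/-! ### The moment form as a linear map and the vector form of its equivariance (`𝕜 = ℚ_p`) -/

section Spec

variable {p : ℕ} [Fact p.Prime]

/-- Coefficient vectors of binary forms over `ℚ_p` are determined by the form as a function
(`HidaOrdinaryCohomologySymPow.toPoly_injective` and `MvPolynomial.funext`). [folklore] -/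
theorem eq_of_evalVec_eq' {k : ℕ} {x y : Fin (k + 1) → ℚ_[p]}
    (h : ∀ w : Fin 2 → ℚ_[p], evalVec k x w = evalVec k y w) : x = y := by
  apply toPoly_injective
  apply MvPolynomial.funext
  intro w
  rw [← evalVec_eq_eval, ← evalVec_eq_eval, h w]

/-- **The moment form of `μ |_k γ` is `Symᵏ(γ) · formOf k μ`** (vector form of
`evalVec_formOf_weightAct`). [cite: Bellaiche2011, §3.2.3] -/
theorem formOf_weightAct (D : BoundedDistribution (ProfiniteTower.padicInt p) ℚ_[p]) (k : ℕ)
    {a c : ℤ_[p]} (ha : ‖a‖ = 1) (hc : ‖c‖ < 1) (b d : ℤ_[p]) :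
    (D.weightAct k ha hc b d).formOf k = symPow k (BoundedDistribution.matK a b c d) *ᵥ D.formOf k :=
  eq_of_evalVec_eq' fun w => by rw [D.evalVec_formOf_weightAct, evalVec_symPow_mulVec]

/-- The moment form depends only on the level data. [folklore] -/
theorem formOf_congr_μ {D E : BoundedDistribution (ProfiniteTower.padicInt p) ℚ_[p]} (h : D.μ = E.μ) (k : ℕ) :
    D.formOf k = E.formOf k := by
  funext i
  rw [BoundedDistribution.formOf_apply, BoundedDistribution.formOf_apply, BoundedDistribution.integral_congr_μ h]

variable (p) in
/-- **The moment form as a linear map `𝔻(ℤ_p) → ℚ_p^{k+1}`.** [cite: Bellaiche2011, §3.2.3] -/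
def formOfₗ (k : ℕ) : (ProfiniteTower.padicInt p).distributions ℚ_[p] →ₗ[ℚ_[p]] (Fin (k + 1) → ℚ_[p]) where
  toFun μ := (ProfiniteTower.toBounded μ.2).formOf k
  map_add' μ ν := by
    funext i
    have huc : UniformContinuous fun z : ℤ_[p] => algebraMap ℚ_[p] ℚ_[p] (z : ℚ_[p]) ^ (i : ℕ) :=
      CompactSpace.uniformContinuous_of_continuous (by fun_prop)
    simp only [Pi.add_apply, BoundedDistribution.formOf_apply, BoundedDistribution.integral_eq_integralFn,
      ProfiniteTower.toBounded_μ, Submodule.coe_add]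
    rw [ProfiniteTower.integralFn_add μ.2 ν.2 huc, mul_add]
  map_smul' r μ := by
    funext i
    have huc : UniformContinuous fun z : ℤ_[p] => algebraMap ℚ_[p] ℚ_[p] (z : ℚ_[p]) ^ (i : ℕ) :=
      CompactSpace.uniformContinuous_of_continuous (by fun_prop)
    simp only [Pi.smul_apply, smul_eq_mul, RingHom.id_apply, BoundedDistribution.formOf_apply,
      BoundedDistribution.integral_eq_integralFn, ProfiniteTower.toBounded_μ, Submodule.coe_smul]
    rw [ProfiniteTower.integralFn_smul r μ.2 huc]
    ring

/-- Unfolding `formOfₗ`. [folklore] -/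
theorem formOfₗ_apply (k : ℕ) (μ : (ProfiniteTower.padicInt p).distributions ℚ_[p]) :
    formOfₗ p k μ = (ProfiniteTower.toBounded μ.2).formOf k := rfl

/-- The level data of `toBounded (weightActD … μ)` are those of `(toBounded μ).weightAct …`. [folklore] -/
theorem toBounded_weightActD_μ (k : ℕ) {a c : ℤ_[p]} (ha : ‖a‖ = 1) (hc : ‖c‖ < 1) (b d : ℤ_[p])
    (μ : (ProfiniteTower.padicInt p).distributions ℚ_[p]) :
    (ProfiniteTower.toBounded (weightActD p ℚ_[p] k ha hc b d μ).2).μ =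
      ((ProfiniteTower.toBounded μ.2).weightAct k ha hc b d).μ := rfl

/-- **Equivariance of `formOfₗ`**: `formOfₗ k (μ |_k γ) = Symᵏ(γ) · formOfₗ k μ`.
[cite: Bellaiche2011, §3.2.3] -/
theorem formOfₗ_weightActD (k : ℕ) {a c : ℤ_[p]} (ha : ‖a‖ = 1) (hc : ‖c‖ < 1) (b d : ℤ_[p])
    (μ : (ProfiniteTower.padicInt p).distributions ℚ_[p]) :
    formOfₗ p k (weightActD p ℚ_[p] k ha hc b d μ) =
      symPow k (BoundedDistribution.matK a b c d) *ᵥ formOfₗ p k μ := by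
  rw [formOfₗ_apply, formOfₗ_apply, formOf_congr_μ (toBounded_weightActD_μ k ha hc b d μ) k, formOf_weightAct]

/-- The `ℚ_p`-matrix of an integer matrix is `matK` of its entries. [folklore] -/
theorem matK_intCast (M : Matrix (Fin 2) (Fin 2) ℤ) :
    BoundedDistribution.matK (𝕜 := ℚ_[p]) ((M 0 0 : ℤ) : ℤ_[p]) ((M 0 1 : ℤ) : ℤ_[p]) ((M 1 0 : ℤ) : ℤ_[p])
      ((M 1 1 : ℤ) : ℤ_[p]) = M.map (Int.castRingHom ℚ_[p]) := by
  ext i j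
  fin_cases i <;> fin_cases j <;> simp [BoundedDistribution.matK, PadicInt.coe_intCast]

variable (p) in
/-- **The specialisation morphism `ρ_k^* : 𝔻_k → Symᵏ`** of coefficient systems on `Σ₀(N)` (`p ∣ N`):
the moment form intertwines `μ ↦ μ|_kM` with `a ↦ Symᵏ(M) a` (`act k M`).
[cite: Bellaiche2011, §3.2.3] -/
def specHom (k N : ℕ) (hpN : p ∣ N) :
    CoeffActionOn.Hom (distCoeff p ℚ_[p] k N hpN) (CoeffActionOn.symPowOn (sigma0Set N) k ℚ_[p]) where
  toLinearMap := formOfₗ p k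
  comm M hM μ := by
    have h := norm_entries_of_mem_sigma0Set (p := p) hpN hM
    change formOfₗ p k (distρ p ℚ_[p] k M μ) = act k M (formOfₗ p k μ)
    rw [distρ_eq k h, formOfₗ_weightActD, act_apply, matK_intCast]

/-- **`𝔻_k`-valued modular symbols for `Γ₀(N)` specialise to `Symᵏ`-valued ones.**
[cite: Bellaiche2011, §3.2.3] -/
theorem spec_mem_Symb (k N : ℕ) (hpN : p ∣ N)
    {φ : P1Q → P1Q → (ProfiniteTower.padicInt p).distributions ℚ_[p]}
    (hφ : φ ∈ (distCoeff p ℚ_[p] k N hpN).Symb (Gamma0 N)) :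
    (specHom p k N hpN).mapFun φ ∈ (CoeffActionOn.symPowOn (sigma0Set N) k ℚ_[p]).Symb (Gamma0 N) :=
  (specHom p k N hpN).mapFun_mem_Symb (fun γ hγ => coe_mem_sigma0Set' γ hγ) hφ

/-- **The specialisation commutes with `U_p`** (`p ∣ N`). [cite: Bellaiche2011, §3.2.3] -/
theorem spec_hecke (k N : ℕ) (hpN : p ∣ N) [NeZero p]
    (φ : P1Q → P1Q → (ProfiniteTower.padicInt p).distributions ℚ_[p]) :
    (specHom p k N hpN).mapFun ((distCoeff p ℚ_[p] k N hpN).hecke N p φ) =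
      (CoeffActionOn.symPowOn (sigma0Set N) k ℚ_[p]).hecke N p ((specHom p k N hpN).mapFun φ) :=
  (specHom p k N hpN).mapFun_hecke (fun i => heckeRep_mem_sigma0Set Fact.out i) φ

end Spec

end Literature.NumberTheory.EllipticCurves

end
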